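import Summits.ValiantsHypothesis.ValiantsHypothesis.Theorems.BarrierLeverPartitionMinorsHitByVPHiddenStatesBallCutCertKit

/-!
# Route BarrierLever — item `PartitionMinorsHitByVP` (stmt-ValiantsHypothesis-19717), line `hidden-states`:
# ★ THIRD-SHELL CORES OF SUPPORT 9 (first half, a–h) ARE SERVED — 8 computational certificates (`Lean.ofReduceBool`), every `h`

Helper file (`--supports stmt-ValiantsHypothesis-19717`, `--computational`; cell valiant-natproofs, 𝒟-side door (c), registered line
`Cruxes/PartitionMinorsHitByVP/Lines/hidden_states.lean` v10; prover seat val-np-p6 gen 22; planner SUGGESTION of record STATUS l.1903).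
Closes NO item.  NO matrix data: each core is `A, C` (the class), then `certTable` (canonical `|B_3(n)| × |B_3(n)|` matrix modulo
`65521` at the formulaic table `stdTable 7 n`), `packedLUP` (in-Lean packed pivoted LU, unverified) and ONE `native_decide` running the
VERIFIED checkers `packCheckP` / `lupPermCheck` of `…ChowBenchmarkPairsBlockPeelCertPack` (val-np-p4 g30); the kernel part is
`BallCut.exists_table_of_packCert[_map]` (`…BallCutCertKit`, val-np-p6 g22): rigidity ⇒ the standard-form matrix is `±` the canonical
integer matrix, nonsingular because its reduction mod `p` is.

THE POINT (memo HOME/val-np-p6/g21/MEMO-valnp6-g21.md §4a; chart kit j328511 of ALL totally unbalanced 3-swap classes at `t = 3`: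
24 231 classes, 24 170 path-certified, 61 CORES).  val-np-p6 g21 made the 23 cores of support `≤ 8` kernel theorems (`…ThirdShellCore36a`
… `…ThirdShellCore38n`, explicit adjugates / column splits); the 38 cores of support `9 … 15` (`130²` … `576²`) were numerical only.
This file: the cores of support 9 (first half, a–h) —
* `core39a`: `A = [[6, 7, 8], [1, 2, 8], [0, 2, 7]]`, `C = [[3, 4, 5, 8], [3, 4, 5, 7], [2, 3, 4, 5]]` (`r = |B_3(9)|`);
* `core39b`: `A = [[6, 7, 8], [1, 7, 8], [1, 6, 8]]`, `C = [[2, 3, 4, 5], [0, 4, 5, 8], [0, 2, 3, 8]]` (`r = |B_3(9)|`);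
* `core39c`: `A = [[6, 7, 8], [2, 3, 5], [1, 3, 4]]`, `C = [[4, 5, 7, 8], [4, 5, 6, 8], [0, 3, 6, 7]]` (`r = |B_3(9)|`);
* `core39d`: `A = [[6, 7, 8], [2, 7, 8], [0, 7, 8]]`, `C = [[3, 4, 5, 8], [1, 4, 5, 7], [1, 3, 4, 5]]` (`r = |B_3(9)|`);
* `core39e`: `A = [[6, 7, 8], [2, 7, 8], [0, 7, 8]]`, `C = [[3, 4, 5, 8], [1, 4, 5, 7], [1, 3, 7, 8]]` (`r = |B_3(9)|`);
* `core39f`: `A = [[6, 7, 8], [2, 7, 8], [0, 7, 8]]`, `C = [[3, 4, 5, 8], [1, 4, 5, 8], [1, 3, 4, 5]]` (`r = |B_3(9)|`);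
* `core39g`: `A = [[6, 7, 8], [2, 7, 8], [0, 7, 8]]`, `C = [[3, 4, 5, 8], [1, 4, 5, 8], [1, 3, 5, 7]]` (`r = |B_3(9)|`);
* `core39h`: `A = [[6, 7, 8], [2, 7, 8], [1, 7, 8]]`, `C = [[3, 4, 5, 8], [3, 4, 5, 7], [0, 3, 4, 5]]` (`r = |B_3(9)|`);
With its siblings (`…ThirdShellCores39A/39B/310/311/312/313315`) ALL 61 cores of the `t = 3` chart are theorems (kernel or computational
lane), so by `exists_table_threeSwap_of_unbalanced` (`…BallCutThirdShellReduction`) `S₃` at `t = 3` holds for every `h` modulo the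
24 170 lab path certificates (each of which this kit would certify the same way).

RANGE BOOKKEEPING: computational lane (`Lean.ofReduceBool` via `native_decide`, one per core); the kernel-only range of the column is
unchanged (cores of support `≤ 8`).  HONEST LABEL: classes of the conjecture column; 19717 stays OPEN; nothing on crux 14610 or VP ≠ VNP.
-/

set_option linter.dupNamespace false

namespace Summit.ValiantsHypothesis.ValiantsHypothesis.Theorems.BarrierLever.HiddenStates

open Finset

namespace BallCut

open SymbJoin MoorePeel

/-! ### Core `core39a`: `n = 9`, `A = [[6, 7, 8], [1, 2, 8], [0, 2, 7]]`, `C = [[3, 4, 5, 8], [3, 4, 5, 7], [2, 3, 4, 5]]` -/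

/-- Core `core39a`: the removed `3`-sets `A_l`. -/
def core39aA : Fin 3 → Finset (Fin 9) := ![{6, 7, 8}, {1, 2, 8}, {0, 2, 7}]

/-- Core `core39a`: the added `4`-sets `C_l`. -/
def core39aC : Fin 3 → Finset (Fin 9) := ![{3, 4, 5, 8}, {3, 4, 5, 7}, {2, 3, 4, 5}]

/-- Core `core39a`: the flat table of the canonical matrix modulo `65521` at `stdTable 7 9` (computed under evaluation). -/
def core39aTab : Array ℕ := certTable 9 3 core39aA core39aC (stdTable 7 9) 65521

/-- Core `core39a`: the packed pivoted LU candidate (unverified; validated by the checkers). -/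
def core39aLUP : Array ℕ × Array ℕ := packedLUP core39aTab (ballList 9 3).length 65521

/-- Core `core39a`: **THE CERTIFICATE CHECK** (computational, `Lean.ofReduceBool`): `L * U = P * M` entrywise mod `65521`, `diag U ≠ 0`,
`P` a permutation — for the `ballList 9 3`-indexed canonical matrix. -/
theorem core39a_check :
    (packCheckP core39aTab core39aLUP.1 core39aLUP.2 (ballList 9 3).length 65521 &&
      lupPermCheck core39aLUP.2 (lupPermInv core39aLUP.2 (ballList 9 3).length) (ballList 9 3).length) = true := by
  native_decide

/-- ★ Core `core39a` **IS SERVED** (standard form at the support `Fin 9`). -/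
theorem exists_table_core39a {r : ℕ} (u cols : Fin r → Finset (Fin 9)) (hu : Function.Injective u)
    (hU : ∀ i, ((u i).card ≤ 3 ∧ ∀ l, u i ≠ core39aA l) ∨ ∃ l, u i = core39aC l)
    (hcols : ∀ J : Finset (Fin 9), J.card ≤ 3 → ∃ k, cols k = J) :
    ∃ tx : Option (Fin 9) → Fin 9 → ℂ,
      (Matrix.of fun i k : Fin r => ∏ a ∈ u i, (tx none a + ∑ q ∈ cols k, tx (some q) a)).det ≠ 0 :=
  exists_table_of_packCert 9 3 core39aA core39aC (by decide +kernel) (by decide +kernel) (by decide +kernel) (by decide +kernel)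
    (stdTable 7 9) prime_65521 (by norm_num [packBase]) _ _ _ (Bool.and_eq_true_iff.mp core39a_check).1
    (Bool.and_eq_true_iff.mp core39a_check).2 u cols hu hU hcols

/-- ★ Core `core39a` **IS SERVED FOR EVERY `h`** (the core plus any number of free coordinates, along any `σ : Fin 9 ↪ Fin h`). -/
theorem exists_table_core39a_map (h : ℕ) (σ : Fin 9 ↪ Fin h) {r : ℕ} (u cols : Fin r → Finset (Fin h))
    (hu : Function.Injective u)
    (hU : ∀ i, ((u i).card ≤ 3 ∧ ∀ l, u i ≠ (core39aA l).map σ) ∨ ∃ l, u i = (core39aC l).map σ)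
    (hcols : ∀ J : Finset (Fin h), J.card ≤ 3 → ∃ k, cols k = J) :
    ∃ tx : Option (Fin h) → Fin h → ℂ,
      (Matrix.of fun i k : Fin r => ∏ a ∈ u i, (tx none a + ∑ q ∈ cols k, tx (some q) a)).det ≠ 0 :=
  exists_table_of_packCert_map 9 3 σ core39aA core39aC (by decide +kernel) (by decide +kernel) (by decide +kernel)
    (by decide +kernel) (stdTable 7 9) prime_65521 (by norm_num [packBase]) _ _ _
    (Bool.and_eq_true_iff.mp core39a_check).1 (Bool.and_eq_true_iff.mp core39a_check).2 u cols hu hU hcols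

/-! ### Core `core39b`: `n = 9`, `A = [[6, 7, 8], [1, 7, 8], [1, 6, 8]]`, `C = [[2, 3, 4, 5], [0, 4, 5, 8], [0, 2, 3, 8]]` -/

/-- Core `core39b`: the removed `3`-sets `A_l`. -/
def core39bA : Fin 3 → Finset (Fin 9) := ![{6, 7, 8}, {1, 7, 8}, {1, 6, 8}]

/-- Core `core39b`: the added `4`-sets `C_l`. -/
def core39bC : Fin 3 → Finset (Fin 9) := ![{2, 3, 4, 5}, {0, 4, 5, 8}, {0, 2, 3, 8}]

/-- Core `core39b`: the flat table of the canonical matrix modulo `65521` at `stdTable 7 9` (computed under evaluation). -/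
def core39bTab : Array ℕ := certTable 9 3 core39bA core39bC (stdTable 7 9) 65521

/-- Core `core39b`: the packed pivoted LU candidate (unverified; validated by the checkers). -/
def core39bLUP : Array ℕ × Array ℕ := packedLUP core39bTab (ballList 9 3).length 65521

/-- Core `core39b`: **THE CERTIFICATE CHECK** (computational, `Lean.ofReduceBool`): `L * U = P * M` entrywise mod `65521`, `diag U ≠ 0`,
`P` a permutation — for the `ballList 9 3`-indexed canonical matrix. -/
theorem core39b_check :
    (packCheckP core39bTab core39bLUP.1 core39bLUP.2 (ballList 9 3).length 65521 &&
      lupPermCheck core39bLUP.2 (lupPermInv core39bLUP.2 (ballList 9 3).length) (ballList 9 3).length) = true := by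
  native_decide

/-- ★ Core `core39b` **IS SERVED** (standard form at the support `Fin 9`). -/
theorem exists_table_core39b {r : ℕ} (u cols : Fin r → Finset (Fin 9)) (hu : Function.Injective u)
    (hU : ∀ i, ((u i).card ≤ 3 ∧ ∀ l, u i ≠ core39bA l) ∨ ∃ l, u i = core39bC l)
    (hcols : ∀ J : Finset (Fin 9), J.card ≤ 3 → ∃ k, cols k = J) :
    ∃ tx : Option (Fin 9) → Fin 9 → ℂ,
      (Matrix.of fun i k : Fin r => ∏ a ∈ u i, (tx none a + ∑ q ∈ cols k, tx (some q) a)).det ≠ 0 :=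
  exists_table_of_packCert 9 3 core39bA core39bC (by decide +kernel) (by decide +kernel) (by decide +kernel) (by decide +kernel)
    (stdTable 7 9) prime_65521 (by norm_num [packBase]) _ _ _ (Bool.and_eq_true_iff.mp core39b_check).1
    (Bool.and_eq_true_iff.mp core39b_check).2 u cols hu hU hcols

/-- ★ Core `core39b` **IS SERVED FOR EVERY `h`** (the core plus any number of free coordinates, along any `σ : Fin 9 ↪ Fin h`). -/
theorem exists_table_core39b_map (h : ℕ) (σ : Fin 9 ↪ Fin h) {r : ℕ} (u cols : Fin r → Finset (Fin h))
    (hu : Function.Injective u)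
    (hU : ∀ i, ((u i).card ≤ 3 ∧ ∀ l, u i ≠ (core39bA l).map σ) ∨ ∃ l, u i = (core39bC l).map σ)
    (hcols : ∀ J : Finset (Fin h), J.card ≤ 3 → ∃ k, cols k = J) :
    ∃ tx : Option (Fin h) → Fin h → ℂ,
      (Matrix.of fun i k : Fin r => ∏ a ∈ u i, (tx none a + ∑ q ∈ cols k, tx (some q) a)).det ≠ 0 :=
  exists_table_of_packCert_map 9 3 σ core39bA core39bC (by decide +kernel) (by decide +kernel) (by decide +kernel)
    (by decide +kernel) (stdTable 7 9) prime_65521 (by norm_num [packBase]) _ _ _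
    (Bool.and_eq_true_iff.mp core39b_check).1 (Bool.and_eq_true_iff.mp core39b_check).2 u cols hu hU hcols

/-! ### Core `core39c`: `n = 9`, `A = [[6, 7, 8], [2, 3, 5], [1, 3, 4]]`, `C = [[4, 5, 7, 8], [4, 5, 6, 8], [0, 3, 6, 7]]` -/

/-- Core `core39c`: the removed `3`-sets `A_l`. -/
def core39cA : Fin 3 → Finset (Fin 9) := ![{6, 7, 8}, {2, 3, 5}, {1, 3, 4}]

/-- Core `core39c`: the added `4`-sets `C_l`. -/
def core39cC : Fin 3 → Finset (Fin 9) := ![{4, 5, 7, 8}, {4, 5, 6, 8}, {0, 3, 6, 7}]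

/-- Core `core39c`: the flat table of the canonical matrix modulo `65521` at `stdTable 7 9` (computed under evaluation). -/
def core39cTab : Array ℕ := certTable 9 3 core39cA core39cC (stdTable 7 9) 65521

/-- Core `core39c`: the packed pivoted LU candidate (unverified; validated by the checkers). -/
def core39cLUP : Array ℕ × Array ℕ := packedLUP core39cTab (ballList 9 3).length 65521

/-- Core `core39c`: **THE CERTIFICATE CHECK** (computational, `Lean.ofReduceBool`): `L * U = P * M` entrywise mod `65521`, `diag U ≠ 0`,
`P` a permutation — for the `ballList 9 3`-indexed canonical matrix. -/
theorem core39c_check :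
    (packCheckP core39cTab core39cLUP.1 core39cLUP.2 (ballList 9 3).length 65521 &&
      lupPermCheck core39cLUP.2 (lupPermInv core39cLUP.2 (ballList 9 3).length) (ballList 9 3).length) = true := by
  native_decide

/-- ★ Core `core39c` **IS SERVED** (standard form at the support `Fin 9`). -/
theorem exists_table_core39c {r : ℕ} (u cols : Fin r → Finset (Fin 9)) (hu : Function.Injective u)
    (hU : ∀ i, ((u i).card ≤ 3 ∧ ∀ l, u i ≠ core39cA l) ∨ ∃ l, u i = core39cC l)
    (hcols : ∀ J : Finset (Fin 9), J.card ≤ 3 → ∃ k, cols k = J) :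
    ∃ tx : Option (Fin 9) → Fin 9 → ℂ,
      (Matrix.of fun i k : Fin r => ∏ a ∈ u i, (tx none a + ∑ q ∈ cols k, tx (some q) a)).det ≠ 0 :=
  exists_table_of_packCert 9 3 core39cA core39cC (by decide +kernel) (by decide +kernel) (by decide +kernel) (by decide +kernel)
    (stdTable 7 9) prime_65521 (by norm_num [packBase]) _ _ _ (Bool.and_eq_true_iff.mp core39c_check).1
    (Bool.and_eq_true_iff.mp core39c_check).2 u cols hu hU hcols

/-- ★ Core `core39c` **IS SERVED FOR EVERY `h`** (the core plus any number of free coordinates, along any `σ : Fin 9 ↪ Fin h`). -/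
theorem exists_table_core39c_map (h : ℕ) (σ : Fin 9 ↪ Fin h) {r : ℕ} (u cols : Fin r → Finset (Fin h))
    (hu : Function.Injective u)
    (hU : ∀ i, ((u i).card ≤ 3 ∧ ∀ l, u i ≠ (core39cA l).map σ) ∨ ∃ l, u i = (core39cC l).map σ)
    (hcols : ∀ J : Finset (Fin h), J.card ≤ 3 → ∃ k, cols k = J) :
    ∃ tx : Option (Fin h) → Fin h → ℂ,
      (Matrix.of fun i k : Fin r => ∏ a ∈ u i, (tx none a + ∑ q ∈ cols k, tx (some q) a)).det ≠ 0 :=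
  exists_table_of_packCert_map 9 3 σ core39cA core39cC (by decide +kernel) (by decide +kernel) (by decide +kernel)
    (by decide +kernel) (stdTable 7 9) prime_65521 (by norm_num [packBase]) _ _ _
    (Bool.and_eq_true_iff.mp core39c_check).1 (Bool.and_eq_true_iff.mp core39c_check).2 u cols hu hU hcols

/-! ### Core `core39d`: `n = 9`, `A = [[6, 7, 8], [2, 7, 8], [0, 7, 8]]`, `C = [[3, 4, 5, 8], [1, 4, 5, 7], [1, 3, 4, 5]]` -/

/-- Core `core39d`: the removed `3`-sets `A_l`. -/
def core39dA : Fin 3 → Finset (Fin 9) := ![{6, 7, 8}, {2, 7, 8}, {0, 7, 8}]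

/-- Core `core39d`: the added `4`-sets `C_l`. -/
def core39dC : Fin 3 → Finset (Fin 9) := ![{3, 4, 5, 8}, {1, 4, 5, 7}, {1, 3, 4, 5}]

/-- Core `core39d`: the flat table of the canonical matrix modulo `65521` at `stdTable 7 9` (computed under evaluation). -/
def core39dTab : Array ℕ := certTable 9 3 core39dA core39dC (stdTable 7 9) 65521

/-- Core `core39d`: the packed pivoted LU candidate (unverified; validated by the checkers). -/
def core39dLUP : Array ℕ × Array ℕ := packedLUP core39dTab (ballList 9 3).length 65521

/-- Core `core39d`: **THE CERTIFICATE CHECK** (computational, `Lean.ofReduceBool`): `L * U = P * M` entrywise mod `65521`, `diag U ≠ 0`,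
`P` a permutation — for the `ballList 9 3`-indexed canonical matrix. -/
theorem core39d_check :
    (packCheckP core39dTab core39dLUP.1 core39dLUP.2 (ballList 9 3).length 65521 &&
      lupPermCheck core39dLUP.2 (lupPermInv core39dLUP.2 (ballList 9 3).length) (ballList 9 3).length) = true := by
  native_decide

/-- ★ Core `core39d` **IS SERVED** (standard form at the support `Fin 9`). -/
theorem exists_table_core39d {r : ℕ} (u cols : Fin r → Finset (Fin 9)) (hu : Function.Injective u)
    (hU : ∀ i, ((u i).card ≤ 3 ∧ ∀ l, u i ≠ core39dA l) ∨ ∃ l, u i = core39dC l)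
    (hcols : ∀ J : Finset (Fin 9), J.card ≤ 3 → ∃ k, cols k = J) :
    ∃ tx : Option (Fin 9) → Fin 9 → ℂ,
      (Matrix.of fun i k : Fin r => ∏ a ∈ u i, (tx none a + ∑ q ∈ cols k, tx (some q) a)).det ≠ 0 :=
  exists_table_of_packCert 9 3 core39dA core39dC (by decide +kernel) (by decide +kernel) (by decide +kernel) (by decide +kernel)
    (stdTable 7 9) prime_65521 (by norm_num [packBase]) _ _ _ (Bool.and_eq_true_iff.mp core39d_check).1
    (Bool.and_eq_true_iff.mp core39d_check).2 u cols hu hU hcols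

/-- ★ Core `core39d` **IS SERVED FOR EVERY `h`** (the core plus any number of free coordinates, along any `σ : Fin 9 ↪ Fin h`). -/
theorem exists_table_core39d_map (h : ℕ) (σ : Fin 9 ↪ Fin h) {r : ℕ} (u cols : Fin r → Finset (Fin h))
    (hu : Function.Injective u)
    (hU : ∀ i, ((u i).card ≤ 3 ∧ ∀ l, u i ≠ (core39dA l).map σ) ∨ ∃ l, u i = (core39dC l).map σ)
    (hcols : ∀ J : Finset (Fin h), J.card ≤ 3 → ∃ k, cols k = J) :
    ∃ tx : Option (Fin h) → Fin h → ℂ,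
      (Matrix.of fun i k : Fin r => ∏ a ∈ u i, (tx none a + ∑ q ∈ cols k, tx (some q) a)).det ≠ 0 :=
  exists_table_of_packCert_map 9 3 σ core39dA core39dC (by decide +kernel) (by decide +kernel) (by decide +kernel)
    (by decide +kernel) (stdTable 7 9) prime_65521 (by norm_num [packBase]) _ _ _
    (Bool.and_eq_true_iff.mp core39d_check).1 (Bool.and_eq_true_iff.mp core39d_check).2 u cols hu hU hcols

/-! ### Core `core39e`: `n = 9`, `A = [[6, 7, 8], [2, 7, 8], [0, 7, 8]]`, `C = [[3, 4, 5, 8], [1, 4, 5, 7], [1, 3, 7, 8]]` -/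

/-- Core `core39e`: the removed `3`-sets `A_l`. -/
def core39eA : Fin 3 → Finset (Fin 9) := ![{6, 7, 8}, {2, 7, 8}, {0, 7, 8}]

/-- Core `core39e`: the added `4`-sets `C_l`. -/
def core39eC : Fin 3 → Finset (Fin 9) := ![{3, 4, 5, 8}, {1, 4, 5, 7}, {1, 3, 7, 8}]

/-- Core `core39e`: the flat table of the canonical matrix modulo `65521` at `stdTable 7 9` (computed under evaluation). -/
def core39eTab : Array ℕ := certTable 9 3 core39eA core39eC (stdTable 7 9) 65521

/-- Core `core39e`: the packed pivoted LU candidate (unverified; validated by the checkers). -/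
def core39eLUP : Array ℕ × Array ℕ := packedLUP core39eTab (ballList 9 3).length 65521

/-- Core `core39e`: **THE CERTIFICATE CHECK** (computational, `Lean.ofReduceBool`): `L * U = P * M` entrywise mod `65521`, `diag U ≠ 0`,
`P` a permutation — for the `ballList 9 3`-indexed canonical matrix. -/
theorem core39e_check :
    (packCheckP core39eTab core39eLUP.1 core39eLUP.2 (ballList 9 3).length 65521 &&
      lupPermCheck core39eLUP.2 (lupPermInv core39eLUP.2 (ballList 9 3).length) (ballList 9 3).length) = true := by
  native_decide

/-- ★ Core `core39e` **IS SERVED** (standard form at the support `Fin 9`). -/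
theorem exists_table_core39e {r : ℕ} (u cols : Fin r → Finset (Fin 9)) (hu : Function.Injective u)
    (hU : ∀ i, ((u i).card ≤ 3 ∧ ∀ l, u i ≠ core39eA l) ∨ ∃ l, u i = core39eC l)
    (hcols : ∀ J : Finset (Fin 9), J.card ≤ 3 → ∃ k, cols k = J) :
    ∃ tx : Option (Fin 9) → Fin 9 → ℂ,
      (Matrix.of fun i k : Fin r => ∏ a ∈ u i, (tx none a + ∑ q ∈ cols k, tx (some q) a)).det ≠ 0 :=
  exists_table_of_packCert 9 3 core39eA core39eC (by decide +kernel) (by decide +kernel) (by decide +kernel) (by decide +kernel)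
    (stdTable 7 9) prime_65521 (by norm_num [packBase]) _ _ _ (Bool.and_eq_true_iff.mp core39e_check).1
    (Bool.and_eq_true_iff.mp core39e_check).2 u cols hu hU hcols

/-- ★ Core `core39e` **IS SERVED FOR EVERY `h`** (the core plus any number of free coordinates, along any `σ : Fin 9 ↪ Fin h`). -/
theorem exists_table_core39e_map (h : ℕ) (σ : Fin 9 ↪ Fin h) {r : ℕ} (u cols : Fin r → Finset (Fin h))
    (hu : Function.Injective u)
    (hU : ∀ i, ((u i).card ≤ 3 ∧ ∀ l, u i ≠ (core39eA l).map σ) ∨ ∃ l, u i = (core39eC l).map σ)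
    (hcols : ∀ J : Finset (Fin h), J.card ≤ 3 → ∃ k, cols k = J) :
    ∃ tx : Option (Fin h) → Fin h → ℂ,
      (Matrix.of fun i k : Fin r => ∏ a ∈ u i, (tx none a + ∑ q ∈ cols k, tx (some q) a)).det ≠ 0 :=
  exists_table_of_packCert_map 9 3 σ core39eA core39eC (by decide +kernel) (by decide +kernel) (by decide +kernel)
    (by decide +kernel) (stdTable 7 9) prime_65521 (by norm_num [packBase]) _ _ _
    (Bool.and_eq_true_iff.mp core39e_check).1 (Bool.and_eq_true_iff.mp core39e_check).2 u cols hu hU hcols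

/-! ### Core `core39f`: `n = 9`, `A = [[6, 7, 8], [2, 7, 8], [0, 7, 8]]`, `C = [[3, 4, 5, 8], [1, 4, 5, 8], [1, 3, 4, 5]]` -/

/-- Core `core39f`: the removed `3`-sets `A_l`. -/
def core39fA : Fin 3 → Finset (Fin 9) := ![{6, 7, 8}, {2, 7, 8}, {0, 7, 8}]

/-- Core `core39f`: the added `4`-sets `C_l`. -/
def core39fC : Fin 3 → Finset (Fin 9) := ![{3, 4, 5, 8}, {1, 4, 5, 8}, {1, 3, 4, 5}]

/-- Core `core39f`: the flat table of the canonical matrix modulo `65521` at `stdTable 7 9` (computed under evaluation). -/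
def core39fTab : Array ℕ := certTable 9 3 core39fA core39fC (stdTable 7 9) 65521

/-- Core `core39f`: the packed pivoted LU candidate (unverified; validated by the checkers). -/
def core39fLUP : Array ℕ × Array ℕ := packedLUP core39fTab (ballList 9 3).length 65521

/-- Core `core39f`: **THE CERTIFICATE CHECK** (computational, `Lean.ofReduceBool`): `L * U = P * M` entrywise mod `65521`, `diag U ≠ 0`,
`P` a permutation — for the `ballList 9 3`-indexed canonical matrix. -/
theorem core39f_check :
    (packCheckP core39fTab core39fLUP.1 core39fLUP.2 (ballList 9 3).length 65521 &&
      lupPermCheck core39fLUP.2 (lupPermInv core39fLUP.2 (ballList 9 3).length) (ballList 9 3).length) = true := by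
  native_decide

/-- ★ Core `core39f` **IS SERVED** (standard form at the support `Fin 9`). -/
theorem exists_table_core39f {r : ℕ} (u cols : Fin r → Finset (Fin 9)) (hu : Function.Injective u)
    (hU : ∀ i, ((u i).card ≤ 3 ∧ ∀ l, u i ≠ core39fA l) ∨ ∃ l, u i = core39fC l)
    (hcols : ∀ J : Finset (Fin 9), J.card ≤ 3 → ∃ k, cols k = J) :
    ∃ tx : Option (Fin 9) → Fin 9 → ℂ,
      (Matrix.of fun i k : Fin r => ∏ a ∈ u i, (tx none a + ∑ q ∈ cols k, tx (some q) a)).det ≠ 0 :=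
  exists_table_of_packCert 9 3 core39fA core39fC (by decide +kernel) (by decide +kernel) (by decide +kernel) (by decide +kernel)
    (stdTable 7 9) prime_65521 (by norm_num [packBase]) _ _ _ (Bool.and_eq_true_iff.mp core39f_check).1
    (Bool.and_eq_true_iff.mp core39f_check).2 u cols hu hU hcols

/-- ★ Core `core39f` **IS SERVED FOR EVERY `h`** (the core plus any number of free coordinates, along any `σ : Fin 9 ↪ Fin h`). -/
theorem exists_table_core39f_map (h : ℕ) (σ : Fin 9 ↪ Fin h) {r : ℕ} (u cols : Fin r → Finset (Fin h))
    (hu : Function.Injective u)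
    (hU : ∀ i, ((u i).card ≤ 3 ∧ ∀ l, u i ≠ (core39fA l).map σ) ∨ ∃ l, u i = (core39fC l).map σ)
    (hcols : ∀ J : Finset (Fin h), J.card ≤ 3 → ∃ k, cols k = J) :
    ∃ tx : Option (Fin h) → Fin h → ℂ,
      (Matrix.of fun i k : Fin r => ∏ a ∈ u i, (tx none a + ∑ q ∈ cols k, tx (some q) a)).det ≠ 0 :=
  exists_table_of_packCert_map 9 3 σ core39fA core39fC (by decide +kernel) (by decide +kernel) (by decide +kernel)
    (by decide +kernel) (stdTable 7 9) prime_65521 (by norm_num [packBase]) _ _ _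
    (Bool.and_eq_true_iff.mp core39f_check).1 (Bool.and_eq_true_iff.mp core39f_check).2 u cols hu hU hcols

/-! ### Core `core39g`: `n = 9`, `A = [[6, 7, 8], [2, 7, 8], [0, 7, 8]]`, `C = [[3, 4, 5, 8], [1, 4, 5, 8], [1, 3, 5, 7]]` -/

/-- Core `core39g`: the removed `3`-sets `A_l`. -/
def core39gA : Fin 3 → Finset (Fin 9) := ![{6, 7, 8}, {2, 7, 8}, {0, 7, 8}]

/-- Core `core39g`: the added `4`-sets `C_l`. -/
def core39gC : Fin 3 → Finset (Fin 9) := ![{3, 4, 5, 8}, {1, 4, 5, 8}, {1, 3, 5, 7}]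

/-- Core `core39g`: the flat table of the canonical matrix modulo `65521` at `stdTable 7 9` (computed under evaluation). -/
def core39gTab : Array ℕ := certTable 9 3 core39gA core39gC (stdTable 7 9) 65521

/-- Core `core39g`: the packed pivoted LU candidate (unverified; validated by the checkers). -/
def core39gLUP : Array ℕ × Array ℕ := packedLUP core39gTab (ballList 9 3).length 65521

/-- Core `core39g`: **THE CERTIFICATE CHECK** (computational, `Lean.ofReduceBool`): `L * U = P * M` entrywise mod `65521`, `diag U ≠ 0`,
`P` a permutation — for the `ballList 9 3`-indexed canonical matrix. -/
theorem core39g_check :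
    (packCheckP core39gTab core39gLUP.1 core39gLUP.2 (ballList 9 3).length 65521 &&
      lupPermCheck core39gLUP.2 (lupPermInv core39gLUP.2 (ballList 9 3).length) (ballList 9 3).length) = true := by
  native_decide

/-- ★ Core `core39g` **IS SERVED** (standard form at the support `Fin 9`). -/
theorem exists_table_core39g {r : ℕ} (u cols : Fin r → Finset (Fin 9)) (hu : Function.Injective u)
    (hU : ∀ i, ((u i).card ≤ 3 ∧ ∀ l, u i ≠ core39gA l) ∨ ∃ l, u i = core39gC l)
    (hcols : ∀ J : Finset (Fin 9), J.card ≤ 3 → ∃ k, cols k = J) :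
    ∃ tx : Option (Fin 9) → Fin 9 → ℂ,
      (Matrix.of fun i k : Fin r => ∏ a ∈ u i, (tx none a + ∑ q ∈ cols k, tx (some q) a)).det ≠ 0 :=
  exists_table_of_packCert 9 3 core39gA core39gC (by decide +kernel) (by decide +kernel) (by decide +kernel) (by decide +kernel)
    (stdTable 7 9) prime_65521 (by norm_num [packBase]) _ _ _ (Bool.and_eq_true_iff.mp core39g_check).1
    (Bool.and_eq_true_iff.mp core39g_check).2 u cols hu hU hcols

/-- ★ Core `core39g` **IS SERVED FOR EVERY `h`** (the core plus any number of free coordinates, along any `σ : Fin 9 ↪ Fin h`). -/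
theorem exists_table_core39g_map (h : ℕ) (σ : Fin 9 ↪ Fin h) {r : ℕ} (u cols : Fin r → Finset (Fin h))
    (hu : Function.Injective u)
    (hU : ∀ i, ((u i).card ≤ 3 ∧ ∀ l, u i ≠ (core39gA l).map σ) ∨ ∃ l, u i = (core39gC l).map σ)
    (hcols : ∀ J : Finset (Fin h), J.card ≤ 3 → ∃ k, cols k = J) :
    ∃ tx : Option (Fin h) → Fin h → ℂ,
      (Matrix.of fun i k : Fin r => ∏ a ∈ u i, (tx none a + ∑ q ∈ cols k, tx (some q) a)).det ≠ 0 :=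
  exists_table_of_packCert_map 9 3 σ core39gA core39gC (by decide +kernel) (by decide +kernel) (by decide +kernel)
    (by decide +kernel) (stdTable 7 9) prime_65521 (by norm_num [packBase]) _ _ _
    (Bool.and_eq_true_iff.mp core39g_check).1 (Bool.and_eq_true_iff.mp core39g_check).2 u cols hu hU hcols

/-! ### Core `core39h`: `n = 9`, `A = [[6, 7, 8], [2, 7, 8], [1, 7, 8]]`, `C = [[3, 4, 5, 8], [3, 4, 5, 7], [0, 3, 4, 5]]` -/

/-- Core `core39h`: the removed `3`-sets `A_l`. -/
def core39hA : Fin 3 → Finset (Fin 9) := ![{6, 7, 8}, {2, 7, 8}, {1, 7, 8}]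

/-- Core `core39h`: the added `4`-sets `C_l`. -/
def core39hC : Fin 3 → Finset (Fin 9) := ![{3, 4, 5, 8}, {3, 4, 5, 7}, {0, 3, 4, 5}]

/-- Core `core39h`: the flat table of the canonical matrix modulo `65521` at `stdTable 7 9` (computed under evaluation). -/
def core39hTab : Array ℕ := certTable 9 3 core39hA core39hC (stdTable 7 9) 65521

/-- Core `core39h`: the packed pivoted LU candidate (unverified; validated by the checkers). -/
def core39hLUP : Array ℕ × Array ℕ := packedLUP core39hTab (ballList 9 3).length 65521

/-- Core `core39h`: **THE CERTIFICATE CHECK** (computational, `Lean.ofReduceBool`): `L * U = P * M` entrywise mod `65521`, `diag U ≠ 0`,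
`P` a permutation — for the `ballList 9 3`-indexed canonical matrix. -/
theorem core39h_check :
    (packCheckP core39hTab core39hLUP.1 core39hLUP.2 (ballList 9 3).length 65521 &&
      lupPermCheck core39hLUP.2 (lupPermInv core39hLUP.2 (ballList 9 3).length) (ballList 9 3).length) = true := by
  native_decide

/-- ★ Core `core39h` **IS SERVED** (standard form at the support `Fin 9`). -/
theorem exists_table_core39h {r : ℕ} (u cols : Fin r → Finset (Fin 9)) (hu : Function.Injective u)
    (hU : ∀ i, ((u i).card ≤ 3 ∧ ∀ l, u i ≠ core39hA l) ∨ ∃ l, u i = core39hC l)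
    (hcols : ∀ J : Finset (Fin 9), J.card ≤ 3 → ∃ k, cols k = J) :
    ∃ tx : Option (Fin 9) → Fin 9 → ℂ,
      (Matrix.of fun i k : Fin r => ∏ a ∈ u i, (tx none a + ∑ q ∈ cols k, tx (some q) a)).det ≠ 0 :=
  exists_table_of_packCert 9 3 core39hA core39hC (by decide +kernel) (by decide +kernel) (by decide +kernel) (by decide +kernel)
    (stdTable 7 9) prime_65521 (by norm_num [packBase]) _ _ _ (Bool.and_eq_true_iff.mp core39h_check).1
    (Bool.and_eq_true_iff.mp core39h_check).2 u cols hu hU hcols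

/-- ★ Core `core39h` **IS SERVED FOR EVERY `h`** (the core plus any number of free coordinates, along any `σ : Fin 9 ↪ Fin h`). -/
theorem exists_table_core39h_map (h : ℕ) (σ : Fin 9 ↪ Fin h) {r : ℕ} (u cols : Fin r → Finset (Fin h))
    (hu : Function.Injective u)
    (hU : ∀ i, ((u i).card ≤ 3 ∧ ∀ l, u i ≠ (core39hA l).map σ) ∨ ∃ l, u i = (core39hC l).map σ)
    (hcols : ∀ J : Finset (Fin h), J.card ≤ 3 → ∃ k, cols k = J) :
    ∃ tx : Option (Fin h) → Fin h → ℂ,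
      (Matrix.of fun i k : Fin r => ∏ a ∈ u i, (tx none a + ∑ q ∈ cols k, tx (some q) a)).det ≠ 0 :=
  exists_table_of_packCert_map 9 3 σ core39hA core39hC (by decide +kernel) (by decide +kernel) (by decide +kernel)
    (by decide +kernel) (stdTable 7 9) prime_65521 (by norm_num [packBase]) _ _ _
    (Bool.and_eq_true_iff.mp core39h_check).1 (Bool.and_eq_true_iff.mp core39h_check).2 u cols hu hU hcols

end BallCut

end Summit.ValiantsHypothesis.ValiantsHypothesis.Theorems.BarrierLever.HiddenStates
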